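import Literature.NumberTheory.LFunctions.DirichletLTruncationCertificatesMean
import HarnessLib

/-!
# No real zero for the odd real primitive character of conductor `1012`, in the kernel (mean certificate)

Topic `Literature/NumberTheory/LFunctions`; namespace `Literature.NumberTheory.LFunctions`. ONE THEOREM (no
definition, no named fact, no `sorry`): **`noRealZeroOdd_modulus_1012`** — for the primitive quadratic ODD
character mod `1012 = 4·253` (the imaginary quadratic field of discriminant `−1012`, `h(−1012) = 4`) and every
`σ ∈ (0, 1)`, `L(σ, χ) ≠ 0`.

This conductor is the hardest below `1100` for the truncation method: the one-period truncation
`∑_{n ≤ 1012} χ(n)/√n = −0.072…` is NEGATIVE and even four periods give `−0.014…` (the central value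
`L(1/2, χ)` is small), so neither a Fekete–Pólya certificate (none of order `≤ 24`, induced modulus `≤ 3·10⁶`)
nor the plain drift certificate `certDriftOK` applies.  The MEAN certificate `LTruncationCert.certMeanOK v 1012 4 32 32`
(`DirichletLTruncationCertificatesMean.lean`) adds the drift term `h̄ (Kq+1)^{−σ}` with `h̄ = U(q)/q = 4` to the
four-period truncation on `32` cells: worst cell margin `0.012` at `σ = 1/2` (integer model of the checker).  Kept
in its own file because of its kernel cost (`N₀ = 4048` terms, `64`-th roots: a few minutes).
[cite: Chua2005RealZeros, §2.2 ALGO 1]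

## References

* K. S. Chua, *Real zeros of Dedekind zeta functions of real quadratic fields*, Math. Comp. 74 (2005)
  1457–1470, §2. [Chua2005RealZeros]
* M. Watkins, *Real zeros of real odd Dirichlet L-functions*, Math. Comp. 73 (2004) 415–423. [Watkins2004RealZeros]
-/

namespace Literature.NumberTheory.LFunctions

open LTruncationCert

/-- **`χ_{−1012}` has no real zero in `(0, 1)`** (mean certificate, `K = 4` periods, `J = 32` cells, `P = 32`).
[cite: Watkins2004RealZeros, main theorem (here re-proved in the kernel)] -/
theorem noRealZeroOdd_modulus_1012 :
    ∀ χ : DirichletCharacter ℂ 1012, χ.IsQuadratic → χ.IsPrimitive → χ.Odd →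
      ∀ σ : ℝ, 0 < σ → σ < 1 → χ.LFunction σ ≠ 0 :=
  good_odd_of_four_mean (by decide) (by decide) 4 32 32 (by decide +kernel)

end Literature.NumberTheory.LFunctions
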